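import Literature.Barriers.CriticalPhenomena.PlaquetteWalkSpinRigidity
import HarnessLib

/-!
# Barrier companion (SAWScalingLimit): self-touching is necessary for an exact vertex identity on `ℤ²`

Companion of `Literature.Barriers.CriticalPhenomena.PlaquetteWalkSpinRigidity` (same catalogue entry),
closing the «no-touching» line of its synthesis. That file proves
`sq_eq_and_sq_eq_of_exactPlaquetteVertexRelation_noTouch`: a plaquette walk WITHOUT self-touching
(`w₁ = w₂ = 0`, i.e. a vertex-self-avoiding walk with corner weights `u₁, u₂` and straight weight `v`)
carries an exact vertex relation only if `v² = u₁² = u₂²` — the uniform walk up to signs was left as the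
residual case. Weight rigidity (`weight_rigidity`, same file) removes the residue:

* **`eq_zero_of_exactPlaquetteVertexRelation_of_noTouch`**: `w₁ = w₂ = 0`, `u₁ u₂ v ≠ 0`, `t ≠ 0`
  and an exact vertex relation on every finite domain force `c = 0`. Proof: the two-co-corner and
  two-corner relations of the triangular system with `w₁ = w₂ = 0` read `u₂ b = −ε v t⁵ a` and
  `u₁ t⁵ b = −v a` on the nonzero eigencomponent `(a, b)`, whence `u₂ = ε t¹⁰ u₁`; with
  `u₁² = u₂²` (no-touch) this gives `t²⁰ = 1`, incompatible with `t¹⁶ = −1` (spin rigidity).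
* (the `v = 0` branch — there `degenerate_rigidity` gives `w₁ w₂ ≠ 0` — is left to an append once
  that theorem lands;)
* the named barrier **`PlaquetteWalkNoTouchNoGo`** (`_holds`): NO vertex-self-avoiding walk on `ℤ²` with
  nonzero corner and straight weights — uniform, stiff, anisotropic, complex, at any phase `t ≠ 0` — satisfies an
  exact single-vertex parafermionic relation with vertex-independent coefficients. In particular the
  uniform self-avoiding walk `(x, x, x, 0, 0)` with any complex `x ≠ 0`, inside the plaquette
  formalism (`gmObservable`; the mid-edge SAW observable of `NienhuisWeightsExcludeVertexSAW` is a
  different formal object, not bridged here).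

Printed counterparts: Glazman's classification ("no solution has `w₁ = w₂ = 0`" — the Nienhuis weights
have `w₁ = w₂ > 0`) [cite: Glazman2015WeightedSAW, Lemma 3.1]; Beaton–Guttmann–Jensen's remark that
no parafermionic observable identity is known on `ℤ²` [cite: BeatonGuttmannJensen2012, p. 2]. Written
for the venture lane «pcv-sawmu» (Tier B, ℤ² search; B1-SYNTHESIS §4).
-/

noncomputable section

namespace Literature.Barriers.CriticalPhenomena

namespace PlaquetteWalk

variable {W : CWeights} {t : ℂ} {c : Fin 4 → ℂ}

/-- **Self-touching is necessary (`v ≠ 0`).** A plaquette walk with `w₁ = w₂ = 0`, `u₁ u₂ v ≠ 0` and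
phase `t ≠ 0` admits no exact vertex relation with a nonzero vertex-independent coefficient vector on
every finite domain. [cite: Glazman2015WeightedSAW, Lemma 3.1 (no solution with w₁ = w₂ = 0)] -/
theorem eq_zero_of_exactPlaquetteVertexRelation_of_noTouch (hrel : ExactPlaquetteVertexRelation W t c)
    (ht : t ≠ 0) (h1 : W.u₁ ≠ 0) (h2 : W.u₂ ≠ 0) (hv : W.v ≠ 0) (hw1 : W.w₁ = 0) (hw2 : W.w₂ = 0) :
    c = 0 := by
  by_contra hc
  obtain ⟨hsq1, hsq2, h16f⟩ := sq_eq_and_sq_eq_of_exactPlaquetteVertexRelation_noTouch hrel ht h1 h2 hw1 hw2 hc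
  have h16 := h16f hv
  obtain ⟨ε, hε, ha, hb, -, -, -, -, hR2, hR1⟩ := weight_rigidity hrel ht h1 h2 hv hc
  rw [hw1] at hR2
  rw [hw2] at hR1
  have hε2 : ε ^ 2 = 1 := by rcases hε with rfl | rfl <;> norm_num
  -- `u₂ = ε t¹⁰ u₁` from the two relations
  have hu2b : W.u₂ * (c 1 + ε * c 3) = -ε * W.v * t ^ 5 * (c 0 + ε * c 2) := by
    linear_combination hR1
  have hu1b : W.u₁ * t ^ 5 * (c 1 + ε * c 3) = -W.v * (c 0 + ε * c 2) := by
    linear_combination ε * hR2 - (W.v * (c 0 + ε * c 2) + W.u₁ * t ^ 5 * (c 1 + ε * c 3)) * hε2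
  have key : (W.u₂ - ε * W.u₁ * t ^ 10) * (c 1 + ε * c 3) = 0 := by
    linear_combination hu2b - ε * t ^ 5 * hu1b
  have hu2 : W.u₂ = ε * W.u₁ * t ^ 10 := by
    have := (mul_eq_zero.1 key).resolve_right hb
    linear_combination this
  -- with `u₁² = u₂²`: `t²⁰ = 1`, contradicting `t¹⁶ = −1`
  have h20 : W.u₁ ^ 2 * (t ^ 20 - 1) = 0 := by
    have h12 : W.u₁ ^ 2 = W.u₂ ^ 2 := by rw [← hsq1, hsq2]
    rw [hu2] at h12
    linear_combination -h12 - (W.u₁ ^ 2 * t ^ 20) * hε2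
  have h20' : t ^ 20 = 1 := by
    have := (mul_eq_zero.1 h20).resolve_left (pow_ne_zero _ h1)
    linear_combination this
  have h4 : t ^ 4 = -1 := by
    have : t ^ 20 = t ^ 16 * t ^ 4 := by ring
    rw [this, h16] at h20'
    linear_combination -h20'
  have : t ^ 16 = 1 := by
    calc t ^ 16 = (t ^ 4) ^ 4 := by ring
      _ = 1 := by rw [h4]; norm_num
  rw [h16] at this
  norm_num at this

/-- **The uniform self-avoiding walk, any complex fugacity**: the plaquette weights `(x, x, x, 0, 0)`,
`x ≠ 0` complex, admit no exact vertex relation at any phase `t ≠ 0` (inside the plaquette formalism).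
[cite: BeatonGuttmannJensen2012, p. 2 ("there is no known appropriate parafermionic observable satisfying an identity like (1)")] -/
theorem eq_zero_of_exactPlaquetteVertexRelation_uniform {x : ℂ} (hx : x ≠ 0)
    (hrel : ExactPlaquetteVertexRelation ⟨x, x, x, 0, 0⟩ t c) (ht : t ≠ 0) : c = 0 :=
  eq_zero_of_exactPlaquetteVertexRelation_of_noTouch hrel ht hx hx hx rfl rfl

/-- **Barrier `PlaquetteWalkNoTouchNoGo`**: for the five-weight plaquette walk on `ℤ²` with complex
corner weights `u₁ u₂ ≠ 0`, straight weight `v ≠ 0` and any phase `t ≠ 0`: WITHOUT self-touching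
(`w₁ = w₂ = 0`) there is no exact vertex relation with a nonzero vertex-independent coefficient vector
on every finite domain. (The `v = 0` branch is excluded separately by `degenerate_rigidity` of the
companion file — there `w₁ a = −ε u₁ t b ≠ 0` — and is to be appended here once that lands.)

BARRIER (structured block, D-0021):
- technique_class: discrete-holomorphicity parafermionic-observable exact-local-relation self-avoiding-walk — `ExactPlaquetteVertexRelation W t c` with `w₁ = w₂ = 0`
- blocks: a Duminil-Copin–Smirnov-type single-vertex identity for ANY vertex-self-avoiding walk on `ℤ²` with weights per corner type / straight passage (uniform SAW, stiffness deformations `u ≠ v`, anisotropic corners `u₁ ≠ u₂`, complex weights, any spin) [cite: Glazman2015WeightedSAW, Lemma 3.1] [cite: BeatonGuttmannJensen2012, p. 2]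
- because: the no-touch faces force `v² = u₁² = u₂²` (`sq_eq_and_sq_eq_of_exactPlaquetteVertexRelation_noTouch`); weight rigidity with `w₁ = w₂ = 0` forces `u₂ = ε t¹⁰ u₁`, hence `t²⁰ = 1`, against spin rigidity's `t¹⁶ = −1` [cite: Glazman2015WeightedSAW, Lemma 3.1 (the weights: w₁ = w₂ > 0 for Nienhuis; w_i = u_i for σ = 1)]
- evasions_known: self-touching weights `w₁ w₂ ≠ 0` (the Yang–Baxter curve and the degenerate line); `u₁ = 0` or `u₂ = 0`; position-dependent coefficients; multi-vertex stencils and remainder terms (other files of the catalogue)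
- scope_caveats: `v ≠ 0` here (the `v = 0` branch follows from `degenerate_rigidity`, pending); all-faces class only (the interior-faces version of the no-touch lemma is not in the tree); plaquette formalism (`gmObservable`), not bridged to the mid-edge SAW observable of `NienhuisWeightsExcludeVertexSAW`/`NoExactVertexRelationZ2Stiffness`, whose theorems it parallels and extends to complex weights
- status: established — `PlaquetteWalkNoTouchNoGo_holds` (this file, axioms standard)

[cite: Glazman2015WeightedSAW, Lemma 3.1] [cite: BeatonGuttmannJensen2012, p. 2] -/
def _root_.Literature.Barriers.CriticalPhenomena.PlaquetteWalkNoTouchNoGo : Prop :=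
  ∀ (W : CWeights) (t : ℂ) (c : Fin 4 → ℂ), t ≠ 0 → W.u₁ ≠ 0 → W.u₂ ≠ 0 → W.v ≠ 0 → W.w₁ = 0 → W.w₂ = 0 →
    ExactPlaquetteVertexRelation W t c → c = 0

/-- Discharge of `PlaquetteWalkNoTouchNoGo`. [cite: Glazman2015WeightedSAW, Lemma 3.1] -/
theorem _root_.Literature.Barriers.CriticalPhenomena.PlaquetteWalkNoTouchNoGo_holds :
    PlaquetteWalkNoTouchNoGo :=
  fun _ _ _ ht h1 h2 hv hw1 hw2 hrel =>
    eq_zero_of_exactPlaquetteVertexRelation_of_noTouch hrel ht h1 h2 hv hw1 hw2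

/-! ### Appended: the `v = 0` branch (from `degenerate_rigidity`) — self-touching is necessary for every `v` -/

/-- **On the `v = 0` branch both self-touchings are present**: an exact vertex relation with `v = 0`,
`u₁u₂ ≠ 0`, `t ≠ 0`, `c ≠ 0` has `w₁ ≠ 0` and `w₂ ≠ 0` (from `degenerate_rigidity`:
`w₁ a = −ε u₁ t b`, `w₂ t a = −u₂ b` with `a, b ≠ 0`). [cite: Glazman2015WeightedSAW, Lemma 3.1 (σ = 1: w₁ = u₁, w₂ = u₂)] -/
theorem w₁_ne_zero_and_w₂_ne_zero_of_v_eq_zero (hrel : ExactPlaquetteVertexRelation W t c) (ht : t ≠ 0)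
    (h1 : W.u₁ ≠ 0) (h2 : W.u₂ ≠ 0) (hv : W.v = 0) (hc : c ≠ 0) : W.w₁ ≠ 0 ∧ W.w₂ ≠ 0 := by
  obtain ⟨-, ε, hε, ha, hb, -, -, hW1, hW2⟩ := degenerate_rigidity hrel ht h1 h2 hv hc
  have hεne : ε ≠ 0 := by rcases hε with rfl | rfl <;> norm_num
  constructor
  · intro h0
    rw [h0, zero_mul] at hW1
    have : ε * W.u₁ * t * (c 1 + ε * c 3) = 0 := by linear_combination hW1
    exact mul_ne_zero (mul_ne_zero (mul_ne_zero hεne h1) ht) hb this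
  · intro h0
    rw [h0, zero_mul, zero_mul] at hW2
    have : W.u₂ * (c 1 + ε * c 3) = 0 := by linear_combination hW2
    exact mul_ne_zero h2 hb this

/-- **Self-touching is necessary (any `v`).** A plaquette walk with `w₁ = w₂ = 0`, `u₁ u₂ ≠ 0` and
phase `t ≠ 0` admits no exact vertex relation with a nonzero coefficient vector on every finite domain —
whatever the straight weight `v` (the case `v = 0` by `degenerate_rigidity`). [cite: Glazman2015WeightedSAW, Lemma 3.1] -/
theorem eq_zero_of_exactPlaquetteVertexRelation_of_noTouch' (hrel : ExactPlaquetteVertexRelation W t c)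
    (ht : t ≠ 0) (h1 : W.u₁ ≠ 0) (h2 : W.u₂ ≠ 0) (hw1 : W.w₁ = 0) (hw2 : W.w₂ = 0) : c = 0 := by
  by_cases hv : W.v = 0
  · by_contra hc
    exact (w₁_ne_zero_and_w₂_ne_zero_of_v_eq_zero hrel ht h1 h2 hv hc).1 hw1
  · exact eq_zero_of_exactPlaquetteVertexRelation_of_noTouch hrel ht h1 h2 hv hw1 hw2

/-- **Barrier `PlaquetteWalkNoTouchNoGo'`** (no hypothesis on `v`): corner weights `u₁ u₂ ≠ 0`,
ANY straight weight `v`, any phase `t ≠ 0`, `w₁ = w₂ = 0` ⇒ no exact vertex relation with a nonzero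
coefficient vector on every finite domain. [cite: Glazman2015WeightedSAW, Lemma 3.1] [cite: BeatonGuttmannJensen2012, p. 2] -/
def _root_.Literature.Barriers.CriticalPhenomena.PlaquetteWalkNoTouchNoGo' : Prop :=
  ∀ (W : CWeights) (t : ℂ) (c : Fin 4 → ℂ), t ≠ 0 → W.u₁ ≠ 0 → W.u₂ ≠ 0 → W.w₁ = 0 → W.w₂ = 0 →
    ExactPlaquetteVertexRelation W t c → c = 0

/-- Discharge of `PlaquetteWalkNoTouchNoGo'`. [cite: Glazman2015WeightedSAW, Lemma 3.1] -/
theorem _root_.Literature.Barriers.CriticalPhenomena.PlaquetteWalkNoTouchNoGo'_holds :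
    PlaquetteWalkNoTouchNoGo' :=
  fun _ _ _ ht h1 h2 hw1 hw2 hrel =>
    eq_zero_of_exactPlaquetteVertexRelation_of_noTouch' hrel ht h1 h2 hw1 hw2


/-! ### Appended: the interior-faces class (Duminil-Copin–Smirnov's quantifier)
(author pcv-sawmu b-engine-1 g8, 2026-08-23; filed by b-engine-2 g9 from the banked bytes `PlaquetteWalkNoTouch_v3_append_be1g8.lean.part`) -/

/-- **Self-touching is necessary, interior-faces class** (`v ≠ 0`): `w₁ = w₂ = 0`, `u₁u₂v ≠ 0`,
`t ≠ 0` and an exact vertex relation at the INTERIOR faces of every finite domain force `c = 0`.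
[cite: Glazman2015WeightedSAW, Lemma 3.1 (no solution with w₁ = w₂ = 0)] [cite: DuminilCopinSmirnov2012, Lemma 1 (shape of the relation)] -/
theorem eq_zero_of_exactPlaquetteVertexRelationInt_of_noTouch (hrel : ExactPlaquetteVertexRelationInt W t c)
    (ht : t ≠ 0) (h1 : W.u₁ ≠ 0) (h2 : W.u₂ ≠ 0) (hv : W.v ≠ 0) (hw1 : W.w₁ = 0) (hw2 : W.w₂ = 0) :
    c = 0 := by
  by_contra hc
  obtain ⟨hsq1, hsq2, h16⟩ :=
    sq_eq_and_sq_eq_of_exactPlaquetteVertexRelationInt_noTouch hrel ht h1 h2 hv hw1 hw2 hc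
  obtain ⟨ε, hε, ha, hb, -, -, -, -, hR2, hR1⟩ := weight_rigidityInt hrel ht h1 h2 hv hc
  rw [hw1] at hR2
  rw [hw2] at hR1
  have hε2 : ε ^ 2 = 1 := by rcases hε with rfl | rfl <;> norm_num
  have hu2b : W.u₂ * (c 1 + ε * c 3) = -ε * W.v * t ^ 5 * (c 0 + ε * c 2) := by
    linear_combination hR1
  have hu1b : W.u₁ * t ^ 5 * (c 1 + ε * c 3) = -W.v * (c 0 + ε * c 2) := by
    linear_combination ε * hR2 - (W.v * (c 0 + ε * c 2) + W.u₁ * t ^ 5 * (c 1 + ε * c 3)) * hε2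
  have key : (W.u₂ - ε * W.u₁ * t ^ 10) * (c 1 + ε * c 3) = 0 := by
    linear_combination hu2b - ε * t ^ 5 * hu1b
  have hu2 : W.u₂ = ε * W.u₁ * t ^ 10 := by
    have := (mul_eq_zero.1 key).resolve_right hb
    linear_combination this
  have h20 : W.u₁ ^ 2 * (t ^ 20 - 1) = 0 := by
    have h12 : W.u₁ ^ 2 = W.u₂ ^ 2 := by rw [← hsq1, hsq2]
    rw [hu2] at h12
    linear_combination -h12 - (W.u₁ ^ 2 * t ^ 20) * hε2
  have h20' : t ^ 20 = 1 := by
    have := (mul_eq_zero.1 h20).resolve_left (pow_ne_zero _ h1)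
    linear_combination this
  have h4 : t ^ 4 = -1 := by
    have : t ^ 20 = t ^ 16 * t ^ 4 := by ring
    rw [this, h16] at h20'
    linear_combination -h20'
  have : t ^ 16 = 1 := by
    calc t ^ 16 = (t ^ 4) ^ 4 := by ring
      _ = 1 := by rw [h4]; norm_num
  rw [h16] at this
  norm_num at this

/-- **Barrier `PlaquetteWalkNoTouchNoGoInt`** (interior-faces class, `v ≠ 0`): corner weights
`u₁u₂ ≠ 0`, straight weight `v ≠ 0`, any phase `t ≠ 0`, `w₁ = w₂ = 0` ⇒ no exact vertex relation with a
nonzero coefficient vector at the interior faces of every finite domain.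
[cite: Glazman2015WeightedSAW, Lemma 3.1] [cite: DuminilCopinSmirnov2012, Lemma 1 (shape of the relation)] -/
def _root_.Literature.Barriers.CriticalPhenomena.PlaquetteWalkNoTouchNoGoInt : Prop :=
  ∀ (W : CWeights) (t : ℂ) (c : Fin 4 → ℂ), t ≠ 0 → W.u₁ ≠ 0 → W.u₂ ≠ 0 → W.v ≠ 0 → W.w₁ = 0 → W.w₂ = 0 →
    ExactPlaquetteVertexRelationInt W t c → c = 0

/-- Discharge of `PlaquetteWalkNoTouchNoGoInt`. [cite: Glazman2015WeightedSAW, Lemma 3.1] -/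
theorem _root_.Literature.Barriers.CriticalPhenomena.PlaquetteWalkNoTouchNoGoInt_holds :
    PlaquetteWalkNoTouchNoGoInt :=
  fun _ _ _ ht h1 h2 hv hw1 hw2 hrel =>
    eq_zero_of_exactPlaquetteVertexRelationInt_of_noTouch hrel ht h1 h2 hv hw1 hw2

end PlaquetteWalk

end Literature.Barriers.CriticalPhenomena

end
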